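import Summits.AtomisticToContinuum.FouriersLaw.Theorems.BondHeatUncertaintyExtensiveSnapshotIrreversibilityEnergyWindowSkeletonMixedVariationA

/-!
# Energy window, part W-4 — the mixed (starting point, skeleton) second variation of the flow — file 2 of 2 (sequel of `…BondHeatUncertaintyExtensiveSnapshotIrreversibilityEnergyWindowSkeletonMixedVariationA`)

Split for the 400-line cap; the module docstring of file 1 describes the whole part.
This file holds §4 (pathwise bound on the mixed second variation), §5 (moments), §6 (window form).
Same namespace, same section variables; no instance / notation / option; no proof holes.
[folklore]
-/

noncomputable section

namespace Summit.AtomisticToContinuum.FouriersLaw.Theorems.ExtensiveSnapshotIrreversibility.EnergyWindow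

open MeasureTheory Filter Topology unitInterval Set
open scoped ENNReal NNReal ContDiff Real
open Literature.MathematicalPhysics.KineticTheory.HeatConduction
open Literature.Probability.Process Literature.Analysis.ODE

section Joint

variable {ω₂ lam β γ : ℝ} (hω : 0 < ω₂) (hl : 0 ≤ lam) (hβ : 0 ≤ β) (hγ : 0 ≤ γ) (N : ℕ)
  (T_L T_R : ℝ)

/-! ## 4. The pathwise bound on the mixed second variation -/

include hω hl hβ hγ in
/-- **Pathwise Grönwall bound for the mixed (starting point, skeleton) second variation of the
flow**, for EVERY remainder `r`, skeleton `x`, directions `v` (starting point) and `δ` (skeleton)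
and `s ∈ [0, 1]`:
`‖D_x(D_z X_s^{m}(·, r, ·)[v])(x)[δ]‖ ≤ max(|c_L|,|c_R|) · ‖v‖ · skelAbsSum δ ·
exp(∫₀ˢ (3A₀ + (3A₁ + B₁) √H(X_u^{m}(z, r, x))) du)` — second-variation equation of the joint family
(V-a) + Grönwall with forcing (T-a1) + the drift bounds of S′a / V-b1 + §3 / T-a1 for the two
first variations. [folklore] [cite: CuneoEckmannHairerReyBellet2018, §3 eq. (3.4)] -/
theorem norm_fderiv_fderiv_skelFlowMapAt_mixed_le {s : ℝ} (hs : s ∈ Icc (0 : ℝ) 1) (m : ℕ)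
    (z : PhaseSpace N) (r : WienerPair) (x : PairSkeleton m) (v : PhaseSpace N)
    (δ : PairSkeleton m) :
    ‖fderiv ℝ (fun y => fderiv ℝ (fun z' => skelFlowMapAt ω₂ lam β γ N T_L T_R s m z' r y) z v)
        x δ‖ ≤
      max |ampL ω₂ lam β γ T_L| |ampR ω₂ lam β γ T_R| * ‖v‖ * skelAbsSum δ *
        Real.exp (∫ u in (0 : ℝ)..s, (3 * driftA₀ ω₂ γ N +
          (3 * driftA₁ lam β N + driftB₁ ω₂ lam β N) *
            √((pinnedChain ω₂ lam β γ).hamiltonian N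
              (skelFlowMapAt ω₂ lam β γ N T_L T_R u m z r x)))) := by
  set S' := skelJointCurve hω hl hβ hγ N T_L T_R m r with hS'
  have hSd : ContDiff ℝ ∞ S' := contDiff_skelJointCurve hω hl hβ hγ N T_L T_R m r
  -- Step 1: the target is the second derivative of the joint family, evaluated at `s`
  rw [fderiv_fderiv_skelFlowMapAt_mixed_eq hω hl hβ hγ N T_L T_R hs m z r x v δ]
  -- Step 2: the second-variation equation (V-a), `D²g' = 0`
  have hY2 : ContDiff ℝ ((1 : ℕ∞) + 1 : ℕ∞) ((pinnedChain ω₂ lam β γ).drift N) :=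
    pinnedChain_contDiff_drift ω₂ lam β γ N
  have hg2 : ContDiff ℝ ((1 : ℕ∞) + 1 : ℕ∞) (skelJointForcing ω₂ lam β γ N T_L T_R m r) :=
    contDiff_skelJointForcing ω₂ lam β γ N T_L T_R m r
  have hode := fderiv_fderiv_forcedSolution_family_apply (n := 1) (S := S') hY2 hg2 le_rfl
    (forcedRobbinMap_skelJointCurve hω hl hβ hγ N T_L T_R m r)
    (eq_skelJointCurve_of_forcedRobbinMap_eq_zero hω hl hβ hγ N T_L T_R m r) (z, x)
    (v, (0 : PairSkeleton m)) ((0 : PhaseSpace N), δ)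
  have hDg : fderiv ℝ (fderiv ℝ (skelJointForcing ω₂ lam β γ N T_L T_R m r)) (z, x)
      ((0 : PhaseSpace N), δ) (v, (0 : PairSkeleton m)) = 0 := by
    rw [fderiv_fderiv_skelJointForcing]
    rfl
  -- the clamped curves (they fold into `hode`)
  set W : ℝ → PhaseSpace N := IccExtend zero_le_one
    (fderiv ℝ (fderiv ℝ S') (z, x) ((0 : PhaseSpace N), δ) (v, (0 : PairSkeleton m))) with hW
  set Xc : ℝ → PhaseSpace N := IccExtend zero_le_one (S' (z, x)) with hXc
  set V : ℝ → PhaseSpace N :=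
    IccExtend zero_le_one (fderiv ℝ S' (z, x) (v, (0 : PairSkeleton m))) with hV
  set V' : ℝ → PhaseSpace N :=
    IccExtend zero_le_one (fderiv ℝ S' (z, x) ((0 : PhaseSpace N), δ)) with hV'
  -- the unclamped flow, drift derivative and its `√H` majorant (as in T-a1 / V-b2)
  have hXu : ∀ u ∈ Icc (0 : ℝ) 1, Xc u = skelFlowMapAt ω₂ lam β γ N T_L T_R u m z r x := by
    intro u hu
    rw [hXc, IccExtend_of_mem zero_le_one _ hu]
    rfl
  have hXcont : Continuous fun u => skelFlowMapAt ω₂ lam β γ N T_L T_R u m z r x :=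
    continuous_skelFlowMapAt_time hω hl hβ hγ N T_L T_R m z r x
  have hYtop := pinnedChain_contDiff_drift ω₂ lam β γ N (n := ⊤)
  have hAc : Continuous fun u => fderiv ℝ ((pinnedChain ω₂ lam β γ).drift N)
      (skelFlowMapAt ω₂ lam β γ N T_L T_R u m z r x) :=
    (hYtop.continuous_fderiv (by simp)).comp hXcont
  have hHc := pinnedChain_continuous_hamiltonian ω₂ lam β γ N
  have hac : Continuous fun u => driftA₀ ω₂ γ N + driftA₁ lam β N *
      √((pinnedChain ω₂ lam β γ).hamiltonian N
        (skelFlowMapAt ω₂ lam β γ N T_L T_R u m z r x)) :=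
    continuous_const.add (continuous_const.mul ((hHc.comp hXcont).sqrt))
  have hAa : ∀ t v', ‖(fderiv ℝ ((pinnedChain ω₂ lam β γ).drift N)
      (skelFlowMapAt ω₂ lam β γ N T_L T_R t m z r x)) v'‖ ≤
      (driftA₀ ω₂ γ N + driftA₁ lam β N * √((pinnedChain ω₂ lam β γ).hamiltonian N
        (skelFlowMapAt ω₂ lam β γ N T_L T_R t m z r x))) * ‖v'‖ :=
    fun t v' => norm_fderiv_drift_apply_le hω hl hβ hγ N _ v'
  have ha0 : ∀ t, 0 ≤ driftA₀ ω₂ γ N + driftA₁ lam β N *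
      √((pinnedChain ω₂ lam β γ).hamiltonian N
        (skelFlowMapAt ω₂ lam β γ N T_L T_R t m z r x)) :=
    fun t => add_nonneg (driftA₀_nonneg hω.le hγ N)
      (mul_nonneg (driftA₁_nonneg lam β N) (Real.sqrt_nonneg _))
  -- continuity of the clamped curves and of the forcing integrand
  have hW_c : Continuous W := continuous_IccExtend_coe _
  have hXc_c : Continuous Xc := continuous_IccExtend_coe _
  have hV_c : Continuous V := continuous_IccExtend_coe _
  have hV'_c : Continuous V' := continuous_IccExtend_coe _
  have hY3 := pinnedChain_contDiff_drift ω₂ lam β γ N (n := 3)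
  have hD2c : Continuous fun y => fderiv ℝ (fderiv ℝ ((pinnedChain ω₂ lam β γ).drift N)) y :=
    (hY3.fderiv_right (m := 2) (by norm_num)).continuous_fderiv (by norm_num)
  have hPc : Continuous fun u => fderiv ℝ (fderiv ℝ ((pinnedChain ω₂ lam β γ).drift N))
      (Xc u) (V' u) (V u) :=
    ((hD2c.comp hXc_c).clm_apply hV'_c).clm_apply hV_c
  have hAclc : Continuous fun u => fderiv ℝ ((pinnedChain ω₂ lam β γ).drift N) (Xc u) (W u) :=
    ((hYtop.continuous_fderiv (by simp)).comp hXc_c).clm_apply hW_c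
  -- Step 3: the integral equation of `W` on `[0, s]`, forcing `∫ D²Y[V'][V]`, linear part unclamped
  have heq : ∀ t ∈ Icc (0 : ℝ) s, W t =
      (∫ u in (0 : ℝ)..t, fderiv ℝ (fderiv ℝ ((pinnedChain ω₂ lam β γ).drift N))
        (Xc u) (V' u) (V u)) +
      ∫ u in (0 : ℝ)..t, (fderiv ℝ ((pinnedChain ω₂ lam β γ).drift N)
        (skelFlowMapAt ω₂ lam β γ N T_L T_R u m z r x)) (W u) := by
    intro t ht
    have ht1 : t ∈ Icc (0 : ℝ) 1 := ⟨ht.1, ht.2.trans hs.2⟩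
    have h1 : W t = fderiv ℝ (fderiv ℝ S') (z, x) ((0 : PhaseSpace N), δ)
        (v, (0 : PairSkeleton m)) ⟨t, ht1⟩ := IccExtend_of_mem zero_le_one _ ht1
    rw [h1, hode ⟨t, ht1⟩, hDg, ContinuousMap.zero_apply, zero_add]
    have hcoe : ((⟨t, ht1⟩ : I) : ℝ) = t := rfl
    rw [hcoe, intervalIntegral.integral_add (hPc.intervalIntegrable _ _)
      (hAclc.intervalIntegrable _ _)]
    congr 1
    refine intervalIntegral.integral_congr fun u hu => ?_
    have hu' : u ∈ Icc (0 : ℝ) 1 := by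
      rw [uIcc_of_le ht.1] at hu
      exact ⟨hu.1, hu.2.trans ht1.2⟩
    simp only [hXu u hu']
  -- Step 4: the forcing bound `‖∫₀ᵗ D²Y[V'][V]‖ ≤ Amp ‖v‖ |δ| e^{2 I_s} J_s` on `[0, s]`
  set Amp := max |ampL ω₂ lam β γ T_L| |ampR ω₂ lam β γ T_R| with hAmp
  have hAmp0 : 0 ≤ Amp := le_max_of_le_left (abs_nonneg _)
  set Is := ∫ u in (0 : ℝ)..s, (driftA₀ ω₂ γ N + driftA₁ lam β N *
      √((pinnedChain ω₂ lam β γ).hamiltonian N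
        (skelFlowMapAt ω₂ lam β γ N T_L T_R u m z r x))) with hIs
  set Js := ∫ u in (0 : ℝ)..s, driftB₁ ω₂ lam β N *
      √((pinnedChain ω₂ lam β γ).hamiltonian N
        (skelFlowMapAt ω₂ lam β γ N T_L T_R u m z r x)) with hJs
  have hbc : Continuous fun u => driftB₁ ω₂ lam β N *
      √((pinnedChain ω₂ lam β γ).hamiltonian N
        (skelFlowMapAt ω₂ lam β γ N T_L T_R u m z r x)) :=
    continuous_const.mul ((hHc.comp hXcont).sqrt)
  have hb0 : ∀ u, 0 ≤ driftB₁ ω₂ lam β N *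
      √((pinnedChain ω₂ lam β γ).hamiltonian N
        (skelFlowMapAt ω₂ lam β γ N T_L T_R u m z r x)) :=
    fun u => mul_nonneg (driftB₁_nonneg hl hβ N) (Real.sqrt_nonneg _)
  -- monotonicity of the exponent in time
  have hImono : ∀ u ∈ Icc (0 : ℝ) s, (∫ t in (0 : ℝ)..u, (driftA₀ ω₂ γ N + driftA₁ lam β N *
      √((pinnedChain ω₂ lam β γ).hamiltonian N
        (skelFlowMapAt ω₂ lam β γ N T_L T_R t m z r x)))) ≤ Is :=
    fun u hu => intervalIntegral.integral_mono_interval le_rfl hu.1 hu.2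
      (Filter.Eventually.of_forall fun t => ha0 t) (hac.intervalIntegrable _ _)
  -- first variations: starting-point direction (§3) and skeleton direction (T-a1), `u ∈ [0, s]`
  have hVb : ∀ u ∈ Icc (0 : ℝ) s, ‖V u‖ ≤ ‖v‖ * Real.exp Is := by
    intro u hu
    have hu1 : u ∈ Icc (0 : ℝ) 1 := ⟨hu.1, hu.2.trans hs.2⟩
    have hVu : V u = fderiv ℝ S' (z, x) (v, (0 : PairSkeleton m)) ⟨u, hu1⟩ :=
      IccExtend_of_mem zero_le_one _ hu1
    have h := norm_fderiv_skelFlowMapAt_left_le hω hl hβ hγ N T_L T_R hu1 m z r x v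
    rw [fderiv_skelFlowMapAt_left_eq_fderiv_joint hω hl hβ hγ N T_L T_R hu1 m z r x v] at h
    rw [hVu]
    exact h.trans (mul_le_mul_of_nonneg_left (Real.exp_le_exp.2 (hImono u hu)) (norm_nonneg _))
  have hV'b : ∀ u ∈ Icc (0 : ℝ) s, ‖V' u‖ ≤ Amp * skelAbsSum δ * Real.exp Is := by
    intro u hu
    have hu1 : u ∈ Icc (0 : ℝ) 1 := ⟨hu.1, hu.2.trans hs.2⟩
    have hVu : V' u = fderiv ℝ S' (z, x) ((0 : PhaseSpace N), δ) ⟨u, hu1⟩ :=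
      IccExtend_of_mem zero_le_one _ hu1
    have h := norm_fderiv_skelFlowMapAt_le hω hl hβ hγ N T_L T_R hu1 m z r x δ
    rw [fderiv_skelFlowMapAt_eq_fderiv_joint hω hl hβ hγ N T_L T_R hu1 m z r x δ] at h
    rw [hVu]
    exact h.trans (mul_le_mul_of_nonneg_left (Real.exp_le_exp.2 (hImono u hu))
      (mul_nonneg hAmp0 (skelAbsSum_nonneg δ)))
  set K := Amp * ‖v‖ * skelAbsSum δ * Real.exp Is ^ 2 with hK
  have hK0 : 0 ≤ K := by
    have := skelAbsSum_nonneg δ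
    positivity
  have hPb : ∀ u ∈ Icc (0 : ℝ) s, ‖fderiv ℝ (fderiv ℝ ((pinnedChain ω₂ lam β γ).drift N))
      (Xc u) (V' u) (V u)‖ ≤ K * (driftB₁ ω₂ lam β N *
        √((pinnedChain ω₂ lam β γ).hamiltonian N
          (skelFlowMapAt ω₂ lam β γ N T_L T_R u m z r x))) := by
    intro u hu
    have hu1 : u ∈ Icc (0 : ℝ) 1 := ⟨hu.1, hu.2.trans hs.2⟩
    have h := norm_fderiv_fderiv_drift_le N hω hl hβ (γ := γ) (Xc u) (V' u) (V u)
    rw [hXu u hu1] at h ⊢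
    refine h.trans ?_
    calc driftB₁ ω₂ lam β N * √((pinnedChain ω₂ lam β γ).hamiltonian N
            (skelFlowMapAt ω₂ lam β γ N T_L T_R u m z r x)) * ‖V' u‖ * ‖V u‖
        ≤ driftB₁ ω₂ lam β N * √((pinnedChain ω₂ lam β γ).hamiltonian N
            (skelFlowMapAt ω₂ lam β γ N T_L T_R u m z r x)) *
            (Amp * skelAbsSum δ * Real.exp Is) * (‖v‖ * Real.exp Is) :=
          mul_le_mul (mul_le_mul_of_nonneg_left (hV'b u hu) (hb0 u)) (hVb u hu) (norm_nonneg _)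
            (mul_nonneg (hb0 u) (by have := skelAbsSum_nonneg δ; positivity))
      _ = K * (driftB₁ ω₂ lam β N * √((pinnedChain ω₂ lam β γ).hamiltonian N
            (skelFlowMapAt ω₂ lam β γ N T_L T_R u m z r x))) := by rw [hK]; ring
  have hfb : ∀ t ∈ Icc (0 : ℝ) s, ‖∫ u in (0 : ℝ)..t, fderiv ℝ (fderiv ℝ
      ((pinnedChain ω₂ lam β γ).drift N)) (Xc u) (V' u) (V u)‖ ≤ K * Js := by
    intro t ht
    have hsub : ∀ u ∈ Icc (0 : ℝ) t, u ∈ Icc (0 : ℝ) s := fun u hu => ⟨hu.1, hu.2.trans ht.2⟩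
    calc ‖∫ u in (0 : ℝ)..t, fderiv ℝ (fderiv ℝ ((pinnedChain ω₂ lam β γ).drift N))
          (Xc u) (V' u) (V u)‖
        ≤ ∫ u in (0 : ℝ)..t, ‖fderiv ℝ (fderiv ℝ ((pinnedChain ω₂ lam β γ).drift N))
            (Xc u) (V' u) (V u)‖ := intervalIntegral.norm_integral_le_integral_norm ht.1
      _ ≤ ∫ u in (0 : ℝ)..t, K * (driftB₁ ω₂ lam β N *
            √((pinnedChain ω₂ lam β γ).hamiltonian N
              (skelFlowMapAt ω₂ lam β γ N T_L T_R u m z r x))) :=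
          intervalIntegral.integral_mono_on ht.1 (hPc.norm.intervalIntegrable _ _)
            ((continuous_const.mul hbc).intervalIntegrable _ _) fun u hu => hPb u (hsub u hu)
      _ = K * ∫ u in (0 : ℝ)..t, driftB₁ ω₂ lam β N *
            √((pinnedChain ω₂ lam β γ).hamiltonian N
              (skelFlowMapAt ω₂ lam β γ N T_L T_R u m z r x)) :=
          intervalIntegral.integral_const_mul _ _
      _ ≤ K * Js :=
          mul_le_mul_of_nonneg_left (intervalIntegral.integral_mono_interval le_rfl ht.1 ht.2
            (Filter.Eventually.of_forall fun t' => hb0 t') (hbc.intervalIntegrable _ _)) hK0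
  -- Step 5: Grönwall with forcing (T-a1 §2) on `[0, s]`
  have hmain := norm_le_mul_exp_integral_of_eq_add_integral_of_norm_le (T := s) hW_c hAc hac
    hAa ha0 hfb heq ⟨hs.1, le_rfl⟩
  -- Step 6: `W s` is the target, and `K J_s e^{I_s} ≤ Amp ‖v‖ |δ| e^{3 I_s + J_s}`
  have hWs : W s = fderiv ℝ (fderiv ℝ S') (z, x) ((0 : PhaseSpace N), δ)
      (v, (0 : PairSkeleton m)) ⟨s, hs⟩ := IccExtend_of_mem zero_le_one _ hs
  rw [← hWs]
  refine hmain.trans ?_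
  have hlin : 3 * Is + Js = ∫ u in (0 : ℝ)..s, (3 * driftA₀ ω₂ γ N +
      (3 * driftA₁ lam β N + driftB₁ ω₂ lam β N) *
        √((pinnedChain ω₂ lam β γ).hamiltonian N
          (skelFlowMapAt ω₂ lam β γ N T_L T_R u m z r x))) := by
    have hi1 : IntervalIntegrable (fun u => 3 * (driftA₀ ω₂ γ N + driftA₁ lam β N *
        √((pinnedChain ω₂ lam β γ).hamiltonian N
          (skelFlowMapAt ω₂ lam β γ N T_L T_R u m z r x)))) volume 0 s :=
      (continuous_const.mul hac).intervalIntegrable _ _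
    rw [hIs, hJs, ← intervalIntegral.integral_const_mul,
      ← intervalIntegral.integral_add hi1 (hbc.intervalIntegrable _ _)]
    refine intervalIntegral.integral_congr fun u _ => ?_
    ring
  rw [← hlin]
  have hδ := skelAbsSum_nonneg δ
  calc K * Js * Real.exp Is
      = Amp * ‖v‖ * skelAbsSum δ * (Real.exp Is ^ 2 * Js * Real.exp Is) := by
        rw [hK]; ring
    _ ≤ Amp * ‖v‖ * skelAbsSum δ * Real.exp (3 * Is + Js) :=
        mul_le_mul_of_nonneg_left (exp_sq_mul_mul_exp_le Is Js) (by positivity)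

end Joint

/-! ## 5. Moments along the Brownian path -/

section Moment

variable {ω₂ lam β γ : ℝ} (hω : 0 < ω₂) (hl : 0 ≤ lam) (hβ : 0 ≤ β) (hγ : 0 ≤ γ) {N : ℕ}
  (hN : 0 < N) {T_L T_R : ℝ} (hTL : 0 < T_L) (hTR : 0 < T_R)

include hω hl hβ hγ hN hTL hTR in
/-- **Moments of the mixed second variation along the Brownian path**, for `q ≥ 1`,
`0 < θ < 1/max(T_L, T_R)`, `s ∈ [0, 1]`, every level `m`, start `z`, starting-point direction `v`
and skeleton direction `δ`:
`E ‖D_Ξ(D_z X_s^{m}[v])(z, R_m B, Ξ_m B)[δ]‖^q ≤ (Amp ‖v‖ |δ|)^q ·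
exp(3qA₀ + q²(3A₁ + B₁)²/(4θ) + θγ(T_L + T_R)) · e^{θ H(z)}` (§4 + T-a2's moment engine).
[cite: CuneoEckmannHairerReyBellet2018, §3 eq. (3.4)] -/
theorem lintegral_rpow_norm_fderiv_fderiv_skelFlowMapAt_mixed_le {q : ℝ} (hq : 1 ≤ q) {θ : ℝ}
    (hθ : 0 < θ) (hθ' : θ < 1 / max T_L T_R) {s : ℝ} (hs : s ∈ Icc (0 : ℝ) 1) (m : ℕ)
    (z : PhaseSpace N) (v : PhaseSpace N) (δ : PairSkeleton m) :
    ∫⁻ wp, ENNReal.ofReal ‖fderiv ℝ (fun y => fderiv ℝ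
        (fun z' => skelFlowMapAt ω₂ lam β γ N T_L T_R s m z' (pairRem m wp) y) z v)
        (pairSkel m wp) δ‖ ^ q ∂wienerPair ≤
      ENNReal.ofReal ((max |ampL ω₂ lam β γ T_L| |ampR ω₂ lam β γ T_R| * ‖v‖ *
          skelAbsSum δ) ^ q *
        (Real.exp (q * (3 * driftA₀ ω₂ γ N) +
            q ^ 2 * (3 * driftA₁ lam β N + driftB₁ ω₂ lam β N) ^ 2 / (4 * θ) +
            θ * γ * (T_L + T_R)) *
          Real.exp (θ * (pinnedChain ω₂ lam β γ).hamiltonian N z))) := by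
  have hA₀ := driftA₀_nonneg hω.le hγ N
  refine lintegral_rpow_le_of_le_mul_exp_integral hω hl hβ hγ hN hTL hTR hq hθ hθ' hs z
    (by positivity)
    (mul_nonneg (mul_nonneg (le_max_of_le_left (abs_nonneg _)) (norm_nonneg v))
      (skelAbsSum_nonneg δ))
    (fun wp => norm_nonneg _) fun wp => ?_
  have h := norm_fderiv_fderiv_skelFlowMapAt_mixed_le hω hl hβ hγ N T_L T_R hs m z (pairRem m wp)
    (pairSkel m wp) v δ
  have hI : ∫ u in (0 : ℝ)..s, (3 * driftA₀ ω₂ γ N +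
        (3 * driftA₁ lam β N + driftB₁ ω₂ lam β N) *
          √((pinnedChain ω₂ lam β γ).hamiltonian N
            (skelFlowMapAt ω₂ lam β γ N T_L T_R u m z (pairRem m wp) (pairSkel m wp)))) =
      ∫ u in (0 : ℝ)..s, (3 * driftA₀ ω₂ γ N +
        (3 * driftA₁ lam β N + driftB₁ ω₂ lam β N) *
          √((pinnedChain ω₂ lam β γ).hamiltonian N
            ((pinnedChain ω₂ lam β γ).solMap N T_L T_R u z (pairPath wp)))) := by
    refine intervalIntegral.integral_congr fun u hu => ?_
    have hu' : u ∈ Icc (0 : ℝ) 1 := by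
      rw [uIcc_of_le hs.1] at hu
      exact ⟨hu.1, hu.2.trans hs.2⟩
    simp only [pinnedChain_solMap_eq_skelFlowMapAt hω hl hβ hγ N T_L T_R hu' m z wp]
  rw [hI] at h
  exact h

end Moment

/-! ## 6. The window form (quantifier shape of (JMˣ)₂) -/

/-- **Mixed-variation moments on the temperature window** (`θ = min ε (1/(4T))`,
`C = √(4γT) · exp(3A₀ + q(3A₁ + B₁)²/(4θ) + 4θγT)`; §5 on the bath window, `Amp ≤ √(4γT)`):
for positive parameters, `T > 0`, `N ≥ 1`, `q ≥ 1`, `ε > 0` there is `C` such that for all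
`T_L, T_R ∈ [T/2, 2T]`, `0 ≤ s ≤ 1`, every level `m`, start `z`, directions `v`, `δ`,
`E ‖D_Ξ(D_z X_s^{m}[v])(z, R_m B, Ξ_m B)[δ]‖^q ≤ (C ‖v‖ · skelAbsSum δ · e^{εH(z)})^q`.
[folklore] [cite: CuneoEckmannHairerReyBellet2018, §3 eq. (3.4)] -/
theorem skeletonMixedVariationMoments :
    ∀ ω₂ lam β γ : ℝ, 0 < ω₂ → 0 < lam → 0 < β → 0 < γ → ∀ T : ℝ, 0 < T →
      ∀ N : ℕ, 0 < N → ∀ q ε : ℝ, 1 ≤ q → 0 < ε → ∃ C : ℝ,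
        ∀ T_L T_R : ℝ, T / 2 ≤ T_L → T_L ≤ 2 * T → T / 2 ≤ T_R → T_R ≤ 2 * T →
          ∀ s : ℝ, 0 ≤ s → s ≤ 1 → ∀ (m : ℕ) (z : PhaseSpace N) (v : PhaseSpace N)
            (δ : PairSkeleton m),
            ∫⁻ wp, ENNReal.ofReal ‖fderiv ℝ (fun y => fderiv ℝ
                (fun z' => skelFlowMapAt ω₂ lam β γ N T_L T_R s m z' (pairRem m wp) y) z v)
                (pairSkel m wp) δ‖ ^ q ∂wienerPair ≤
              ENNReal.ofReal ((C * ‖v‖ * skelAbsSum δ *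
                Real.exp (ε * (pinnedChain ω₂ lam β γ).hamiltonian N z)) ^ q) := by
  intro ω₂ lam β γ hω hl hβ hγ T hT N hN q ε hq hε
  have hq0 : 0 ≤ q := zero_le_one.trans hq
  set θ : ℝ := min ε (1 / (4 * T)) with hθdef
  have hθ : 0 < θ := lt_min hε (by positivity)
  have hθε : θ ≤ ε := min_le_left _ _
  have hθT : θ ≤ 1 / (4 * T) := min_le_right _ _
  clear_value θ
  set A₀ := 3 * driftA₀ ω₂ γ N with hA₀
  set A₁ := 3 * driftA₁ lam β N + driftB₁ ω₂ lam β N with hA₁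
  refine ⟨Real.sqrt (4 * γ * T) * Real.exp (A₀ + q * A₁ ^ 2 / (4 * θ) + 4 * θ * γ * T), ?_⟩
  intro T_L T_R hTL1 hTL2 hTR1 hTR2 s hs0 hs1 m z v δ
  have hTL : 0 < T_L := by linarith
  have hTR : 0 < T_R := by linarith
  have hθ' : θ < 1 / max T_L T_R := by
    have hmax : max T_L T_R ≤ 2 * T := max_le hTL2 hTR2
    have h1 : 1 / (2 * T) ≤ 1 / max T_L T_R :=
      one_div_le_one_div_of_le (lt_max_of_lt_left hTL) hmax
    have h2 : 1 / (4 * T) < 1 / (2 * T) := one_div_lt_one_div_of_lt (by positivity) (by linarith)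
    linarith
  have hmain := lintegral_rpow_norm_fderiv_fderiv_skelFlowMapAt_mixed_le hω hl.le hβ.le hγ.le hN
    hTL hTR hq hθ hθ' ⟨hs0, hs1⟩ m z v δ
  refine hmain.trans (ENNReal.ofReal_le_ofReal ?_)
  rw [← hA₀, ← hA₁]
  have hH0 : 0 ≤ (pinnedChain ω₂ lam β γ).hamiltonian N z :=
    pinnedChain_hamiltonian_nonneg hω.le hl.le hβ.le γ N z
  set H := (pinnedChain ω₂ lam β γ).hamiltonian N z with hH
  have hS := skelAbsSum_nonneg δ
  set S := skelAbsSum δ with hSdef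
  have hv := norm_nonneg v
  -- the amplitudes on the window
  have hamp : ∀ T' : ℝ, T' ≤ 2 * T →
      |Real.sqrt (2 * (pinnedChain ω₂ lam β γ).γ * T')| ≤ Real.sqrt (4 * γ * T) := by
    intro T' hT'
    rw [abs_of_nonneg (Real.sqrt_nonneg _)]
    refine Real.sqrt_le_sqrt ?_
    have hγ' : (pinnedChain ω₂ lam β γ).γ = γ := rfl
    rw [hγ']
    nlinarith [hγ.le]
  have hmax : max |ampL ω₂ lam β γ T_L| |ampR ω₂ lam β γ T_R| ≤ Real.sqrt (4 * γ * T) := by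
    show max |Real.sqrt (2 * (pinnedChain ω₂ lam β γ).γ * T_L)|
      |Real.sqrt (2 * (pinnedChain ω₂ lam β γ).γ * T_R)| ≤ _
    exact max_le (hamp T_L hTL2) (hamp T_R hTR2)
  have hmax0 : 0 ≤ max |ampL ω₂ lam β γ T_L| |ampR ω₂ lam β γ T_R| :=
    le_max_of_le_left (abs_nonneg _)
  have hsq0 : 0 ≤ Real.sqrt (4 * γ * T) := Real.sqrt_nonneg _
  -- the three factors
  have h1 : (max |ampL ω₂ lam β γ T_L| |ampR ω₂ lam β γ T_R| * ‖v‖ * S) ^ q ≤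
      (Real.sqrt (4 * γ * T) * ‖v‖ * S) ^ q :=
    Real.rpow_le_rpow (mul_nonneg (mul_nonneg hmax0 hv) hS)
      (mul_le_mul_of_nonneg_right (mul_le_mul_of_nonneg_right hmax hv) hS) hq0
  have h2 : Real.exp (q * A₀ + q ^ 2 * A₁ ^ 2 / (4 * θ) + θ * γ * (T_L + T_R)) ≤
      Real.exp (A₀ + q * A₁ ^ 2 / (4 * θ) + 4 * θ * γ * T) ^ q := by
    rw [← Real.exp_mul, Real.exp_le_exp]
    have h21 : θ * γ * (T_L + T_R) ≤ θ * γ * (4 * T) :=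
      mul_le_mul_of_nonneg_left (by linarith) (mul_nonneg hθ.le hγ.le)
    have h22 : θ * γ * (4 * T) ≤ θ * γ * (4 * T) * q :=
      le_mul_of_one_le_right (by positivity) hq
    have h23 : (A₀ + q * A₁ ^ 2 / (4 * θ) + 4 * θ * γ * T) * q =
        q * A₀ + q ^ 2 * A₁ ^ 2 / (4 * θ) + θ * γ * (4 * T) * q := by ring
    linarith
  have h3 : Real.exp (θ * H) ≤ Real.exp (ε * H) ^ q := by
    rw [← Real.exp_mul, Real.exp_le_exp]
    have h31 : θ * H ≤ ε * H := mul_le_mul_of_nonneg_right hθε hH0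
    have h32 : ε * H ≤ ε * H * q := le_mul_of_one_le_right (by positivity) hq
    linarith
  have hE1 : 0 ≤ Real.exp (A₀ + q * A₁ ^ 2 / (4 * θ) + 4 * θ * γ * T) ^ q :=
    Real.rpow_nonneg (Real.exp_pos _).le q
  calc (max |ampL ω₂ lam β γ T_L| |ampR ω₂ lam β γ T_R| * ‖v‖ * S) ^ q *
        (Real.exp (q * A₀ + q ^ 2 * A₁ ^ 2 / (4 * θ) + θ * γ * (T_L + T_R)) * Real.exp (θ * H))
      ≤ (Real.sqrt (4 * γ * T) * ‖v‖ * S) ^ q *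
          (Real.exp (A₀ + q * A₁ ^ 2 / (4 * θ) + 4 * θ * γ * T) ^ q * Real.exp (ε * H) ^ q) :=
        mul_le_mul h1 (mul_le_mul h2 h3 (Real.exp_pos _).le hE1) (by positivity)
          (Real.rpow_nonneg (mul_nonneg (mul_nonneg hsq0 hv) hS) q)
    _ = (Real.sqrt (4 * γ * T) * Real.exp (A₀ + q * A₁ ^ 2 / (4 * θ) + 4 * θ * γ * T) * ‖v‖ * S *
          Real.exp (ε * H)) ^ q := by
        rw [← Real.mul_rpow (Real.exp_pos _).le (Real.exp_pos _).le,
          ← Real.mul_rpow (mul_nonneg (mul_nonneg hsq0 hv) hS)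
            (mul_nonneg (Real.exp_pos _).le (Real.exp_pos _).le)]
        congr 1
        ring

end Summit.AtomisticToContinuum.FouriersLaw.Theorems.ExtensiveSnapshotIrreversibility.EnergyWindow

end
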